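import Summits.HodgeConjecture.HodgeConjecture.Theorems.LinearSystemTorelliLocalTubeSpanRadical
import Summits.HodgeConjecture.HodgeConjecture.Theorems.LinearSystemTorelliLocalTubeSpanUnimodularChain
import Summits.HodgeConjecture.HodgeConjecture.Theorems.LinearSystemTorelliLocalTubeSpanSaturation

/-!
# Route LinearSystemTorelli — crux `LocalTubeSpan`: connected complete clusters from finite data

Helper file (`--supports stmt-HodgeConjecture-2490`, line `Sketch`, cycle-3 composition
`injective_evalCoinv_of_connectedCluster`).  The crux ("local Schnell theorem", C. Schnell,
*Primitive cohomology and the tube mapping*, Math. Z. 268 (2010) §3, §7) is reduced by the line to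
the injectivity of Schnell's third map `H¹(G, V) → ∏_g V/(g - 1)V` for a local monodromy group `G`
acting on the vanishing cohomology `V` by Picard–Lefschetz transvections `T_δ(x) = x - B(x, δ)δ`
along the local vanishing cycles.  The case theorem for ONE complete orbit
(`localTubeSpan_injective_evalCoinv_of_completeOrbit`, file `…Radical`) is stated over the
infinite orbit `Δ` of all local vanishing cycles.  Geometrically one is handed FINITE data: the
cycles `e(t)` of finitely many local meridians `t ∈ s`, their (integral) intersection numbers, and
the local Dynkin diagram.  This file composes the cycle-3 stubs `stub_unimodularChain`
(`…UnimodularChain`: a chain of `⟨δ, δ'⟩ = ±1` edges puts generator cycles in one orbit) and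
`stub_saturation` (`…Saturation`: the orbit-saturation `⟨s⟩ · e(s)` carries the orbit data) with
the one-orbit theorem:

* `localTubeSpan_injective_evalCoinv_of_connectedCluster` — `G = ⟨s⟩`, `s` finite, acting by
  transvections of an alternating `B` along cycles with integral pairings whose UNIMODULAR DYNKIN
  GRAPH (`t ∼ t'` iff `B(e_t, e_{t'}) = ±1`) is connected and has an edge: granting Schnell's
  Lemma 11 (named fact `Schnell2010_lemma11`, Janssen), the third map is injective.  In particular
  two complete clusters LINKED by a unimodular cross pair (non-orthogonal branches of the local
  discriminant, case 5a of the line card) merge into one complete orbit and are covered.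
* `localTubeSpan_ker_evalCoinvOn_eq_H1resKer_of_connectedCluster` — the same at a subgroup
  `S ≤ G` (a local fundamental group inside `π₁` of the discriminant complement): the line's
  surrogate `ker (evalCoinvOn A S) = H1resKer A S` of the crux.

References: [Schnell2010] C. Schnell, Primitive cohomology and the tube mapping, Math. Z. 268
(2010) §7 Prop. 12 and Lemma 11; W. Janssen, Skew-symmetric vanishing lattices and their monodromy
groups, Math. Ann. 266 (1983) (Thm. 2.5, Lemma 2.7).
-/

-- `Summit.HodgeConjecture.HodgeConjecture.Theorems` is the mandated namespace (single-conjunct summit: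
-- Sub = Summit), which `linter.dupNamespace` flags on every declaration; the lakefile turns the
-- linter off tree-wide (weak option), restated here so stand-alone elaboration is warning-free too.
set_option linter.dupNamespace false

noncomputable section

open CategoryTheory groupCohomology
open Literature.AlgebraicGeometry.HodgeTheory

namespace Summit.HodgeConjecture.HodgeConjecture.Theorems

section ConnectedCluster

variable {G : Type} [Group G] (A : Rep.{0} ℚ G)

/-- **A connected complete cluster from finite data.**  Let `G = ⟨s⟩` (`s` finite) act on the
finite-dimensional `ℚ`-space `V = A` by transvections `x ↦ x - B(x, e_t) e_t` (`t ∈ s`) of an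
alternating form `B`, with integral pairings `B(e_t, e_{t'}) ∈ ℤ`, such that the unimodular Dynkin
graph on `s` (`t ∼ t'` iff `B(e_t, e_{t'}) = ±1`) is connected and some edge has
`B(e_{t₁}, e_{t₂}) = 1`.  Then, granting Schnell's Lemma 11, Schnell's third map
`H¹(G, V) → ∏_{g ∈ G} V/(g - 1)V` is injective.  (The orbit-saturation `Δ = G · e(s)` is a single
orbit by the unimodular chains, and carries the orbit data of
`localTubeSpan_injective_evalCoinv_of_completeOrbit` by `localTubeSpan_saturation`.)
[cite: Schnell2010, §7 Prop. 12 and Lemma 11] -/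
theorem localTubeSpan_injective_evalCoinv_of_connectedCluster (hL11 : Schnell2010_lemma11)
    [FiniteDimensional ℚ A.V] (B : LinearMap.BilinForm ℚ A.V) (hB : B.IsAlt)
    (s : Set G) (hsfin : s.Finite) (hs : Subgroup.closure s = ⊤) (e : G → A.V)
    (hPL : ∀ t ∈ s, ∀ x : A.V, A.ρ t x = x - B x (e t) • e t)
    (hint : ∀ t ∈ s, ∀ t' ∈ s, ∃ n : ℤ, B (e t) (e t') = n)
    (hconn : ∀ t ∈ s, ∀ t' ∈ s, Relation.ReflTransGen
      (fun a b : G => a ∈ s ∧ b ∈ s ∧ (B (e a) (e b) = 1 ∨ B (e a) (e b) = -1)) t t')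
    (hpair : ∃ t₁ ∈ s, ∃ t₂ ∈ s, B (e t₁) (e t₂) = 1) :
    Function.Injective (evalCoinv A) := by
  set Δ : Set A.V := {x : A.V | ∃ g ∈ Subgroup.closure s, ∃ t ∈ s, A.ρ g (e t) = x} with hΔ
  have horb : ∀ t ∈ s, ∀ t' ∈ s, ∃ g ∈ Subgroup.closure s, A.ρ g (e t) = e t' :=
    fun t _ t' _ => localTubeSpan_exists_apply_eq_of_unimodularChain A B hB s e hPL (hconn t ‹_› t' ‹_›)
  obtain ⟨hes, -, hΔG, hfg, hintΔ, hstable, htrans⟩ :=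
    localTubeSpan_saturation A B hB s hsfin e hPL hint horb Δ hΔ
  obtain ⟨t₁, ht₁, t₂, ht₂, h12⟩ := hpair
  refine localTubeSpan_injective_evalCoinv_of_completeOrbit A hL11 B hB Δ s hs
    (fun t ht => ⟨e t, hes t ht, hPL t ht⟩) (fun δ hδ => ?_) hfg hintΔ
    (fun g δ hδ => hstable g (by rw [hs]; exact Subgroup.mem_top g) δ hδ)
    (fun δ hδ δ' hδ' => ?_) ⟨e t₁, hes t₁ ht₁, e t₂, hes t₂ ht₂, h12⟩
  · obtain ⟨g, -, hg⟩ := hΔG δ hδ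
    exact ⟨g, hg⟩
  · obtain ⟨g, -, hg⟩ := htrans δ hδ δ' hδ'
    exact ⟨g, hg⟩

/-- **The surrogate crux at a local group carrying a connected complete cluster.**  For a
subgroup `S ≤ G` generated by finitely many elements acting as transvections (alternating `B`,
integral pairings, connected unimodular Dynkin graph with an edge of pairing `1`), granting
Schnell's Lemma 11: the classes of `H¹(G, A)` undetected by every element of `S` are exactly those
restricting to zero on `S` — `ker (evalCoinvOn A S) = H1resKer A S`.
[cite: Schnell2010, §7 Prop. 12 and Lemma 11] -/
theorem localTubeSpan_ker_evalCoinvOn_eq_H1resKer_of_connectedCluster (hL11 : Schnell2010_lemma11)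
    [FiniteDimensional ℚ A.V] (S : Subgroup G) (B : LinearMap.BilinForm ℚ A.V) (hB : B.IsAlt)
    (s : Set S) (hsfin : s.Finite) (hs : Subgroup.closure s = ⊤) (e : S → A.V)
    (hPL : ∀ t ∈ s, ∀ x : A.V, A.ρ t x = x - B x (e t) • e t)
    (hint : ∀ t ∈ s, ∀ t' ∈ s, ∃ n : ℤ, B (e t) (e t') = n)
    (hconn : ∀ t ∈ s, ∀ t' ∈ s, Relation.ReflTransGen
      (fun a b : S => a ∈ s ∧ b ∈ s ∧ (B (e a) (e b) = 1 ∨ B (e a) (e b) = -1)) t t')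
    (hpair : ∃ t₁ ∈ s, ∃ t₂ ∈ s, B (e t₁) (e t₂) = 1) :
    LinearMap.ker (evalCoinvOn A S) = H1resKer A S :=
  localTubeSpan_ker_evalCoinvOn_eq_H1resKer_of_injective A S
    (localTubeSpan_injective_evalCoinv_of_connectedCluster (Rep.res S.subtype A) hL11 B hB s hsfin
      hs e hPL hint hconn hpair)

end ConnectedCluster

end Summit.HodgeConjecture.HodgeConjecture.Theorems

end
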